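import Mathlib
import HarnessLib
import Summits.CriticalPhenomena.Ising3DConformalLimit.Theses.LocalisationClock

/-!
# Line `semigroup_clock` — crux `TargetOfClock` (stmt-CriticalPhenomena-15884) of route
# `LocalisationClock` (sub-problem `Ising3DConformalLimit`) — crux-strategist ALT line to `birth`

Crux BY NAME: `Summit.CriticalPhenomena.Ising3DConformalLimit.Theses.LocalisationClock.TargetOfClock`
`= LocalisationGHS → ImryMaWindowNoise → Target` (the "clock reading": from the SL-GHS sign and the
window anti-concentration of the critical clock to the floor of the block coupling
`g_L = (3⟨M_L²⟩² − ⟨M_L⁴⟩)/⟨M_L²⟩² ≥ 6ca(b−a)`).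

## The technique (what differs from `Lines/birth.lean`)

`birth` cuts the crux along the route text: a plus-state CLOCK IDENTITY in INTEGRAL form
(`∫_{s₁}^{s₂} E r = Δ E M²`, `IntegrableOn Cov (Ioi 0)`, `6∫₀^∞ Cov = ⟨M⁴⟩ − 3σ⁴`, to be proved by
heat-equation / Gaussian integration by parts on `ℝ^{Λ_L}` — Itô and Stein's lemma are absent from
Mathlib) + sign transfer + envelope, composed through `intervalIntegral`.

This line replaces the integral identity by the MARKOV STRUCTURE of the planted Gaussian channel in
the SNR variable, for a GENERIC finite prior `w` on `{±1}^ι` (`ι` any `Fintype`; the route's `let`s are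
the instance `ι = Λ_L`, `w = w_L`, definitionally — `imryMaWindowNoise_iff`, `target_iff` are `Iff.rfl`):

* `stub_semigroup` — CHAPMAN–KOLMOGOROV / NISHIMORI: `P^w_{s+h}[Φ] = P^w_s[T_h Φ]` with
  `T_h Φ(y₁) = P^{post_w(y₁)}_h[Φ(y₁ + ·)]` (observe at SNR `s`, then from the posterior at SNR `h`),
  plus the Feller property of `T_h`. Proof sketch: the finite-dimensional Cameron–Martin formula (IN
  TREE: `Literature.Probability.Distributions.map_add_eq_withDensity_of_hasGaussianLaw`) applied twice
  is the Nishimori identity `E_τ E_{Z₁}[Σ_τ' post(τ') G(τ', y₁)] = E_τ' E_{Z₁}[G(τ', y₁)]`, and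
  `√s Z₁ + √h Z₂ ~ √(s+h) Z` (`gaussianReal_conv_gaussianReal`, `iIndepFun_pi`).
* `stub_generator` — the GENERATOR of that semigroup on `m²` and `m⁴`, uniformly:
  `T_h(m²) = m² + h·r + O(h^{3/2})`, `T_h(m⁴) = m⁴ + 6h·r m² + O(h^{3/2})`, i.e. a second-order Taylor
  expansion of the tilt `y₂ ↦ m_w(y₁ + y₂)^k` in the fresh field `y₂ = hτ + √h Z₂`; the first-order
  (drift) terms cancel because `τ_x² = 1` (`∂_{x}∂_{x} m = κ₃(τ_x,τ_x,F) = −2 E[τ_x] Cov(τ_x,F)`): this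
  algebraic identity IS the martingale property of the posterior mean, with no stochastic calculus.
* `stub_regularity` (continuity/bounds; joint continuity in (prior, SNR)), `stub_limit` (posterior
  concentration as `s → ∞`), `stub_plusBlockLaw` (the only infinite-volume input: `w_L` is a centred
  probability vector with moments `σ_L², ⟨M_L⁴⟩`, `σ_L² > 0`, and the limit of free-box cylinder
  laws), `stub_freeBoxClockSign` (`LocalisationGHS` on free boxes is verbatim `Cov ≤ 0` for the
  cylinder law `wFree L L'` — the crux hypothesis `LocalisationGHS` is load-bearing HERE).
* Composition `TargetOfClock_of` (sorry-free, §7): the clock in DERIVATIVE form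
  (`HasDerivAt (E m_s²) (E r_s)`, `HasDerivAt (E m_s⁴) (6 E[r_s m_s²])` from semigroup + generator,
  two-sided via continuity of the rates, §4–5), the sign `Cov_{w_L} ≤ 0` (free boxes → `w_L` by
  continuity in the prior, §6), and then ONLY MONOTONICITY: `φ = E m_s²` is nondecreasing
  (`φ' = E r ≥ 0`) from `φ(0) = ⟨M_L⟩² = 0` to `σ_L²`, the window `[s₁, s₂]` exists by the IVT,
  `G = E m⁴ − 3φ²` has `G' = 6 Cov ≤ 0` with `G(0) = 0`, `G(∞) = ⟨M⁴⟩ − 3σ⁴`, and on the window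
  `K = G + 6caσ² φ` has `K' = 6 Cov + 6caσ² E r ≤ 0` (ImryMaWindowNoise), whence
  `⟨M⁴⟩ − 3σ⁴ ≤ G(s₂) ≤ G(s₁) − 6ca(b−a)σ⁴ ≤ −6ca(b−a)σ⁴`: `Target` with `c' = 6ca(b−a)`.
  No `intervalIntegral`, no `IntegrableOn … (Ioi 0)`, no improper integral, no IBP anywhere.

## Disproof used
No `Cruxes/TargetOfClock/Disproof.lean` exists (payload `disproof_path` absent on this hub,
`ledger crux ls`: only `Lines/birth.*`); `ledger negatives --problem CriticalPhenomena`: 11 entries,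
none on this sub-problem, none resembling a stub. Both crux hypotheses are USED (`LocalisationGHS`
by `stub_freeBoxClockSign`, `ImryMaWindowNoise` by the window step of the composition); no stub
restates the crux, `Target`, `LocalisationGHS`, `ImryMaWindowNoise` or the summit (probes in the
line card). Numerics (folder `exp/clock_derivs.py`, pure Python quadrature, generic 2-spin prior):
`φ' = E r`, `(E m⁴)' = 6E[r m²]` to 6 digits at `s ∈ {0.05, 0.3, 1}`, `φ(0⁺) = μ²`, `G(0⁺) = −2μ⁴`,
limits at `s = 25`, and the semigroup identity to `1e-15` (`n = 1`, `s = 0.4`, `h = 0.7`).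

References: A. El Alaoui, A. Montanari, arXiv:2109.00709 §2 (planted Gaussian channel =
stochastic localisation; Nishimori/Bayes structure); R. Eldan, D. Mikulincer, A. Zhai,
arXiv:1806.09087 §1–2 (martingale `M_s`, `Γ_t`; the Itô form of the same identities);
Y. Chen, R. Eldan, arXiv:2203.04163 §2 (localisation schemes as Markov processes of measures);
D. Guo, S. Shamai, S. Verdú, arXiv:cs/0412108 Thm 1–2 (I-MMSE, the integral form used by `birth`);
V. Bogachev, *Gaussian Measures* (1998) Cor. 2.4.3 (Cameron–Martin, in tree as
`GaussianVectorTilt`); M. Aizenman, H. Duminil-Copin, V. Sidoravicius, CMP 334 (2015) Thm 1.2 /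
Cor. 1.5 (`m*(β_c) = 0`, uniqueness; in tree `spontaneousMagnetization_criticalBeta_eq_zero_holds`,
`hasUniqueGibbsMeasure_criticalBeta_holds`); S. Friedli, Y. Velenik (CUP 2017) Thm 3.17, Ex. 3.16
(box limits; in tree `plusExpect_spinFun_eq_integral`, `hasBoxLimit_isingCorr_free_holds`).
-/

noncomputable section

namespace Summit.CriticalPhenomena.Ising3DConformalLimit.Cruxes.TargetOfClock.SemigroupClock

open scoped BigOperators Topology Classical MeasureTheory ProbabilityTheory
open Filter Set MeasureTheory
open Literature.Probability.LatticeModels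
open Summit.CriticalPhenomena.Ising3DConformalLimit.Theses.LocalisationClock
  (Target LocalisationGHS ImryMaWindowNoise TargetOfClock)

/-! ## §0 Generic clock functionals of a finite prior `w` on `{±1}^ι` -/

section Generic

variable {ι : Type} [Fintype ι] [DecidableEq ι]

/-- posterior (tilted) expectation of `g` for the prior `w` and field `y`. [folklore] -/
def tiltG (w : (ι → ℤˣ) → ℝ) (y : ι → ℝ) (g : (ι → ℤˣ) → ℝ) : ℝ :=
  (∑ τ, w τ * g τ * Real.exp (∑ x, y x * ((τ x : ℤ) : ℝ))) /
    (∑ τ, w τ * Real.exp (∑ x, y x * ((τ x : ℤ) : ℝ)))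

/-- posterior block polarisation `m_w(y) = E_y Σ_x τ_x`. [folklore] -/
def mG (w : (ι → ℤˣ) → ℝ) (y : ι → ℝ) : ℝ := tiltG w y (fun τ => ∑ x, ((τ x : ℤ) : ℝ))

/-- posterior covariance `Cov_y(τ_x, Σ τ)`. [folklore] -/
def AfG (w : (ι → ℤˣ) → ℝ) (y : ι → ℝ) (x : ι) : ℝ :=
  tiltG w y (fun τ => ((τ x : ℤ) : ℝ) * ∑ x', ((τ x' : ℤ) : ℝ)) - tiltG w y (fun τ => ((τ x : ℤ) : ℝ)) * mG w y

/-- clock rate `r_w(y) = Σ_x Cov_y(τ_x, Σ τ)²`. [folklore] -/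
def rG (w : (ι → ℤˣ) → ℝ) (y : ι → ℝ) : ℝ := ∑ x, AfG w y x ^ 2

/-- planted expectation at SNR `s`: `Σ_τ w(τ) E Φ(sτ + √s Z)`. [folklore] -/
def PG (w : (ι → ℤˣ) → ℝ) (s : ℝ) (Φ : (ι → ℝ) → ℝ) : ℝ :=
  ∑ τ, w τ * ∫ z, Φ (fun x => s * ((τ x : ℤ) : ℝ) + Real.sqrt s * z x)
    ∂(Measure.pi fun _ : ι => ProbabilityTheory.gaussianReal 0 1)

/-- `φ_w(s) = E m_s²`. [folklore] -/
def phiG (w : (ι → ℤˣ) → ℝ) (s : ℝ) : ℝ := PG w s (fun y => mG w y ^ 2)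
/-- `E m_s⁴`. [folklore] -/
def m4G (w : (ι → ℤˣ) → ℝ) (s : ℝ) : ℝ := PG w s (fun y => mG w y ^ 4)
/-- `E r_s`. [folklore] -/
def rateG (w : (ι → ℤˣ) → ℝ) (s : ℝ) : ℝ := PG w s (rG w)
/-- `E[r_s m_s²]`. [folklore] -/
def xG (w : (ι → ℤˣ) → ℝ) (s : ℝ) : ℝ := PG w s (fun y => rG w y * mG w y ^ 2)
/-- `Cov(r_s, m_s²)`. [folklore] -/
def covG (w : (ι → ℤˣ) → ℝ) (s : ℝ) : ℝ := xG w s - rateG w s * phiG w s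

/-- moments of the block spin under the prior: `Σ_τ w(τ) (Σ_x τ_x)^k`. [folklore] -/
def mom (w : (ι → ℤˣ) → ℝ) (k : ℕ) : ℝ := ∑ τ, w τ * (∑ x, ((τ x : ℤ) : ℝ)) ^ k

/-- probability vectors on `{±1}^ι`. [folklore] -/
def IsProbVec (w : (ι → ℤˣ) → ℝ) : Prop := (∀ τ, 0 ≤ w τ) ∧ ∑ τ, w τ = 1

/-- the posterior given the field `y`, as a new prior (tilts compose additively). [folklore] -/
def post (w : (ι → ℤˣ) → ℝ) (y : ι → ℝ) : (ι → ℤˣ) → ℝ := fun τ =>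
  w τ * Real.exp (∑ x, y x * ((τ x : ℤ) : ℝ)) / ∑ τ', w τ' * Real.exp (∑ x, y x * ((τ' x : ℤ) : ℝ))

/-- the one-step (Markov) operator of the planted channel: observe at SNR `h` starting from the
posterior given `y₁`. [folklore] -/
def TG (w : (ι → ℤˣ) → ℝ) (h : ℝ) (Φ : (ι → ℝ) → ℝ) (y₁ : ι → ℝ) : ℝ :=
  PG (post w y₁) h (fun y₂ => Φ (y₁ + y₂))

end Generic

/-! ## §0' The plus-state block law and the free-box cylinder laws -/

/-- `w_L(τ) = ⟨𝟙{σ|_{Λ_L} = τ}⟩⁺_{β_c(3),0}`. [folklore] -/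
def wL (L : ℕ) (τ : ↥(box 3 L) → ℤˣ) : ℝ :=
  plusExpect 3 (criticalBeta 3) 0 (fun σ => if (∀ x : ↥(box 3 L), σ x = τ x) then 1 else 0)

/-- free-b.c. finite-volume cylinder law of the box `Λ_L` inside `Λ_{L'}` at `β_c(3)`. [folklore] -/
def wFree (L L' : ℕ) (τ : ↥(box 3 L) → ℤˣ) : ℝ :=
  isingExpect (zdGraph 3) (box 3 L') (criticalBeta 3) 0 .free
    (fun σ => if (∀ x : ↥(box 3 L), σ x = τ x) then 1 else 0)

/-- `σ_L² = ⟨M_L²⟩⁺`. [folklore] -/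
def sigma2 (L : ℕ) : ℝ :=
  plusExpect 3 (criticalBeta 3) 0 (fun σ => (∑ x ∈ box 3 L, spinAt x σ) ^ 2)

/-- `⟨M_L⁴⟩⁺`. [folklore] -/
def M4 (L : ℕ) : ℝ :=
  plusExpect 3 (criticalBeta 3) 0 (fun σ => (∑ x ∈ box 3 L, spinAt x σ) ^ 4)

/-- `ImryMaWindowNoise` through the generic functionals at `w = w_L` (definitional). [folklore] -/
theorem imryMaWindowNoise_iff :
    ImryMaWindowNoise ↔
      ∃ a b c : ℝ, 0 < a ∧ a < b ∧ b < 1 ∧ 0 < c ∧ ∃ L₀ : ℕ, ∀ L ≥ L₀, ∀ s : ℝ, 0 ≤ s →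
        a * sigma2 L ≤ phiG (wL L) s → phiG (wL L) s ≤ b * sigma2 L →
          covG (wL L) s ≤ -(c * (rateG (wL L) s * phiG (wL L) s)) :=
  Iff.rfl

/-- `Target` through the abbreviations (definitional). [folklore] -/
theorem target_iff :
    Target ↔ ∃ c : ℝ, 0 < c ∧ ∃ L₀ : ℕ, ∀ L ≥ L₀, c ≤ (3 * sigma2 L ^ 2 - M4 L) / sigma2 L ^ 2 :=
  Iff.rfl


/-! ## §1 The stub statements -/

/-- **CLOCK SEMIGROUP (Chapman–Kolmogorov / Nishimori, with the Feller property).** For a probability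
vector `w`, a bounded continuous test function `Φ` of the field and `s, h ≥ 0`: observing the planted
Gaussian channel at SNR `s + h` is observing it at SNR `s` and then, from the posterior, at SNR `h`:
`P^w_{s+h}[Φ] = P^w_s[T_h Φ]`, `T_h Φ(y₁) = P^{post_w(y₁)}_h[Φ(y₁ + ·)]`, and `T_h Φ` is again continuous
with the same bound. (Cameron–Martin twice = the Nishimori identity, plus `√s Z₁ + √h Z₂ ~ √(s+h) Z`.)
[folklore] -/
def ClockSemigroup : Prop :=
  ∀ (ι : Type) [Fintype ι] [DecidableEq ι] (w : (ι → ℤˣ) → ℝ), IsProbVec w →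
    ∀ (Φ : (ι → ℝ) → ℝ) (C : ℝ), Continuous Φ → (∀ y, |Φ y| ≤ C) →
      ∀ h : ℝ, 0 ≤ h →
        Continuous (TG w h Φ) ∧ (∀ y, |TG w h Φ y| ≤ C) ∧
          ∀ s : ℝ, 0 ≤ s → PG w (s + h) Φ = PG w s (TG w h Φ)

/-- **CLOCK GENERATOR on `m²` and `m⁴` (uniform second-order expansion at SNR `0⁺` from every
posterior).** There is `C = C(ι)` such that for every probability vector `w`, every field `y` and
`0 < h ≤ 1`: `|T_h(m²)(y) − m(y)² − h·r(y)| ≤ C h^{3/2}` and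
`|T_h(m⁴)(y) − m(y)⁴ − 6h·r(y)m(y)²| ≤ C h^{3/2}` (second-order Taylor expansion of the tilt in the
fresh field `hτ + √h Z`; the first-order/drift terms cancel because `τ_x² = 1` — the martingale
property of the posterior mean). [folklore] -/
def ClockGenerator : Prop :=
  ∀ (ι : Type) [Fintype ι] [DecidableEq ι], ∃ C : ℝ, ∀ (w : (ι → ℤˣ) → ℝ), IsProbVec w →
    ∀ h : ℝ, 0 < h → h ≤ 1 → ∀ y : ι → ℝ,
      |TG w h (fun y' => mG w y' ^ 2) y - mG w y ^ 2 - h * rG w y| ≤ C * (h * Real.sqrt h) ∧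
      |TG w h (fun y' => mG w y' ^ 4) y - mG w y ^ 4 - h * (6 * (rG w y * mG w y ^ 2))| ≤
        C * (h * Real.sqrt h)

/-- **CLOCK REGULARITY.** For a probability vector `w`: the posterior polarisation `m_w` and the
rate `r_w` are continuous in the field with `|m_w| ≤ |ι|`, `0 ≤ r_w ≤ 4|ι|³`; and the four planted
functionals `E m_s²`, `E m_s⁴`, `E r_s`, `E[r_s m_s²]` are jointly continuous in (prior, SNR) on
`{probability vectors} × [0, ∞)` (dominated convergence for a bounded continuous integrand against
the standard Gaussian product measure). [folklore] -/
def ClockRegularity : Prop :=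
  ∀ (ι : Type) [Fintype ι] [DecidableEq ι],
    (∀ w : (ι → ℤˣ) → ℝ, IsProbVec w →
      Continuous (mG w) ∧ Continuous (rG w) ∧
        ∀ y, |mG w y| ≤ Fintype.card ι ∧ 0 ≤ rG w y ∧ rG w y ≤ 4 * (Fintype.card ι : ℝ) ^ 3) ∧
    ContinuousOn (fun p : ((ι → ℤˣ) → ℝ) × ℝ => phiG p.1 p.2) ({w | IsProbVec w} ×ˢ Set.Ici 0) ∧
    ContinuousOn (fun p : ((ι → ℤˣ) → ℝ) × ℝ => m4G p.1 p.2) ({w | IsProbVec w} ×ˢ Set.Ici 0) ∧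
    ContinuousOn (fun p : ((ι → ℤˣ) → ℝ) × ℝ => rateG p.1 p.2) ({w | IsProbVec w} ×ˢ Set.Ici 0) ∧
    ContinuousOn (fun p : ((ι → ℤˣ) → ℝ) × ℝ => xG p.1 p.2) ({w | IsProbVec w} ×ˢ Set.Ici 0)

/-- **CLOCK LIMIT (posterior concentration at infinite SNR).** For a probability vector `w`,
`E m_s² → Σ_τ w(τ) F(τ)²` and `E m_s⁴ → Σ_τ w(τ) F(τ)⁴` as `s → ∞` (`F = Σ_x τ_x`): the posterior
given `sτ + √s Z` concentrates on `τ` (likelihood ratios `e^{-2s d_H + O(√s)}`). [folklore] -/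
def ClockLimit : Prop :=
  ∀ (ι : Type) [Fintype ι] [DecidableEq ι] (w : (ι → ℤˣ) → ℝ), IsProbVec w →
    Tendsto (phiG w) atTop (𝓝 (mom w 2)) ∧ Tendsto (m4G w) atTop (𝓝 (mom w 4))

/-- **PLUS-STATE BLOCK LAW (the only infinite-volume input).** For every `L`: `w_L` is a probability
vector with vanishing first moment (`⟨M_L⟩⁺_{β_c} = |Λ_L| m*(β_c(3)) = 0`, ADS 2015), second and
fourth moments `σ_L² = ⟨M_L²⟩⁺ > 0` (Griffiths) and `⟨M_L⁴⟩⁺` (the plus state is the integral against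
a plus Gibbs measure on local observables), and it is the limit of the free-box cylinder laws
`wFree L L'` as `L' → ∞` (GKS box limits + uniqueness of the Gibbs measure at `β_c(3)`: free
state = plus state). [folklore] -/
def PlusBlockLaw : Prop :=
  ∀ L : ℕ, IsProbVec (wL L) ∧ mom (wL L) 1 = 0 ∧ mom (wL L) 2 = sigma2 L ∧ mom (wL L) 4 = M4 L ∧
    0 < sigma2 L ∧ (∀ L' : ℕ, L ≤ L' → IsProbVec (wFree L L')) ∧
    ∀ τ, Tendsto (fun L' : ℕ => wFree L L' τ) atTop (𝓝 (wL L τ))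

/-- **FREE-BOX CLOCK SIGN (finite identification; uses the crux hypothesis `LocalisationGHS`).**
`LocalisationGHS` at `n = |Λ_{L'}|` (sites reindexed by `Fin n ≃ Λ_{L'}`), couplings
`c = β_c(3)·𝟙{a ∼ b}` in the `PairIsing.gibbsAvg` normalisation of the free-b.c. box measure, block
mask `e = 𝟙_{Λ_L}`, is VERBATIM `Cov(r_s, m_s²) ≤ 0` for the generic clock of the cylinder law
`wFree L L'` (the tilt only sees block spins; the off-block Gaussian coordinates integrate out).
[folklore] -/
def FreeBoxClockSign : Prop :=
  LocalisationGHS → ∀ L L' : ℕ, L ≤ L' → ∀ s : ℝ, 0 ≤ s → covG (wFree L L') s ≤ 0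

/-! ## §2 Registered stubs -/

/-- stub 1 (M–L, provable now): the planted-channel semigroup (Cameron–Martin ×2 + Gaussian sum).
[cite: arXiv:2109.00709, §2] -/
theorem stub_semigroup : ClockSemigroup := by
  sorry

/-- stub 2 (L, HARDEST; provable now): the generator on `m²`, `m⁴` — uniform 2nd-order expansion; the
drift cancels by `τ_x² = 1`. [cite: arXiv:1806.09087, §1–2] -/
theorem stub_generator : ClockGenerator := by
  sorry

/-- stub 3 (M, provable now): regularity of the clock functionals (dominated convergence). [folklore] -/
theorem stub_regularity : ClockRegularity := by
  sorry

/-- stub 4 (M, provable now): posterior concentration at infinite SNR. [folklore] -/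
theorem stub_limit : ClockLimit := by
  sorry

/-- stub 5 (M, provable now): the plus-state block law (box limits, `m*(β_c)=0`, uniqueness at `β_c(3)`,
Griffiths). [cite: AizenmanDuminilCopinSidoravicius2015, Thm 1.2 / Cor. 1.5] -/
theorem stub_plusBlockLaw : PlusBlockLaw := by
  sorry

/-- stub 6 (M, provable now; uses the crux hypothesis `LocalisationGHS`): finite identification of the
masked `PairIsing.gibbsAvg` clock functional with the generic clock of `wFree L L'`. [folklore] -/
theorem stub_freeBoxClockSign : FreeBoxClockSign := by
  sorry

namespace Registered
/-- alias keyed by the registered stub name. [folklore] -/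
abbrev stub_semigroup : Prop := ClockSemigroup
/-- alias keyed by the registered stub name. [folklore] -/
abbrev stub_generator : Prop := ClockGenerator
/-- alias keyed by the registered stub name. [folklore] -/
abbrev stub_regularity : Prop := ClockRegularity
/-- alias keyed by the registered stub name. [folklore] -/
abbrev stub_limit : Prop := ClockLimit
/-- alias keyed by the registered stub name. [folklore] -/
abbrev stub_plusBlockLaw : Prop := PlusBlockLaw
/-- alias keyed by the registered stub name. [folklore] -/
abbrev stub_freeBoxClockSign : Prop := FreeBoxClockSign
end Registered


/-! ## §3 Elementary lemmas on the generic functionals (sorry-free) -/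

section Lemmas

variable {ι : Type} [Fintype ι] [DecidableEq ι]

/-- abbreviation-free name for the Gaussian product measure of the channel noise. [folklore] -/
abbrev γι (ι : Type) [Fintype ι] : Measure (ι → ℝ) :=
  Measure.pi fun _ : ι => ProbabilityTheory.gaussianReal 0 1

instance (ι : Type) [Fintype ι] : IsProbabilityMeasure (γι ι) := by
  unfold γι; infer_instance

omit [Fintype ι] [DecidableEq ι] in
/-- the affine channel map `z ↦ sτ + √s z` is continuous. [folklore] -/
theorem continuous_aff (s : ℝ) (τ : ι → ℤˣ) :
    Continuous (fun z : ι → ℝ => fun x => s * ((τ x : ℤ) : ℝ) + Real.sqrt s * z x) := by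
  refine continuous_pi fun x => ?_
  exact continuous_const.add (continuous_const.mul (continuous_apply x))

omit [DecidableEq ι] in
/-- a bounded continuous test function is integrable along the channel. [folklore] -/
theorem integrable_aff {Φ : (ι → ℝ) → ℝ} {C : ℝ} (hΦ : Continuous Φ) (hC : ∀ y, |Φ y| ≤ C)
    (s : ℝ) (τ : ι → ℤˣ) :
    Integrable (fun z : ι → ℝ => Φ (fun x => s * ((τ x : ℤ) : ℝ) + Real.sqrt s * z x)) (γι ι) := by
  refine Integrable.of_bound ((hΦ.comp (continuous_aff s τ)).aestronglyMeasurable) C ?_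
  exact Eventually.of_forall fun z => by rw [Real.norm_eq_abs]; exact hC _

/-- `PG` unfolds to a sum of integrals against `γι`. [folklore] -/
theorem PG_def (w : (ι → ℤˣ) → ℝ) (s : ℝ) (Φ : (ι → ℝ) → ℝ) :
    PG w s Φ = ∑ τ, w τ * ∫ z, Φ (fun x => s * ((τ x : ℤ) : ℝ) + Real.sqrt s * z x) ∂(γι ι) :=
  rfl

/-- linearity of the planted expectation: sums. [folklore] -/
theorem PG_add (w : (ι → ℤˣ) → ℝ) (s : ℝ) {Φ Ψ : (ι → ℝ) → ℝ} {C D : ℝ}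
    (hΦ : Continuous Φ) (hC : ∀ y, |Φ y| ≤ C) (hΨ : Continuous Ψ) (hD : ∀ y, |Ψ y| ≤ D) :
    PG w s (fun y => Φ y + Ψ y) = PG w s Φ + PG w s Ψ := by
  simp only [PG_def, ← Finset.sum_add_distrib, ← mul_add]
  refine Finset.sum_congr rfl fun τ _ => ?_
  rw [integral_add (integrable_aff hΦ hC s τ) (integrable_aff hΨ hD s τ)]

/-- linearity of the planted expectation: scalars. [folklore] -/
theorem PG_const_mul (w : (ι → ℤˣ) → ℝ) (s : ℝ) (Φ : (ι → ℝ) → ℝ) (c : ℝ) :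
    PG w s (fun y => c * Φ y) = c * PG w s Φ := by
  simp only [PG_def, integral_const_mul, Finset.mul_sum]
  refine Finset.sum_congr rfl fun τ _ => ?_
  ring

/-- linearity of the planted expectation: differences. [folklore] -/
theorem PG_sub (w : (ι → ℤˣ) → ℝ) (s : ℝ) {Φ Ψ : (ι → ℝ) → ℝ} {C D : ℝ}
    (hΦ : Continuous Φ) (hC : ∀ y, |Φ y| ≤ C) (hΨ : Continuous Ψ) (hD : ∀ y, |Ψ y| ≤ D) :
    PG w s (fun y => Φ y - Ψ y) = PG w s Φ - PG w s Ψ := by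
  have h1 : (fun y => Φ y - Ψ y) = fun y => Φ y + (-1) * Ψ y := by funext y; ring
  have hΨ' : Continuous fun y => (-1) * Ψ y := continuous_const.mul hΨ
  have hD' : ∀ y, |(-1) * Ψ y| ≤ D := fun y => by simpa using hD y
  rw [h1, PG_add w s hΦ hC hΨ' hD', PG_const_mul]
  ring

/-- the planted expectation of a pointwise-bounded function is bounded (probability vector; no
integrability needed). [folklore] -/
theorem abs_PG_le {w : (ι → ℤˣ) → ℝ} (hw : IsProbVec w) (s : ℝ) {Φ : (ι → ℝ) → ℝ} {C : ℝ}
    (hC : ∀ y, |Φ y| ≤ C) : |PG w s Φ| ≤ C := by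
  have hC0 : 0 ≤ C := (abs_nonneg _).trans (hC 0)
  rw [PG_def]
  calc |∑ τ, w τ * ∫ z, Φ (fun x => s * ((τ x : ℤ) : ℝ) + Real.sqrt s * z x) ∂(γι ι)|
      ≤ ∑ τ, |w τ * ∫ z, Φ (fun x => s * ((τ x : ℤ) : ℝ) + Real.sqrt s * z x) ∂(γι ι)| :=
        Finset.abs_sum_le_sum_abs _ _
    _ ≤ ∑ τ, w τ * C := by
        refine Finset.sum_le_sum fun τ _ => ?_
        rw [abs_mul, abs_of_nonneg (hw.1 τ)]
        refine mul_le_mul_of_nonneg_left ?_ (hw.1 τ)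
        have h := norm_integral_le_of_norm_le_const (μ := γι ι)
          (f := fun z : ι → ℝ => Φ (fun x => s * ((τ x : ℤ) : ℝ) + Real.sqrt s * z x)) (C := C)
          (Eventually.of_forall fun z => by rw [Real.norm_eq_abs]; exact hC _)
        simpa [Real.norm_eq_abs] using h
    _ = C := by rw [← Finset.sum_mul, hw.2, one_mul]

/-- the planted expectation of a nonnegative function is nonnegative. [folklore] -/
theorem PG_nonneg {w : (ι → ℤˣ) → ℝ} (hw : IsProbVec w) (s : ℝ) {Φ : (ι → ℝ) → ℝ}
    (hΦ : ∀ y, 0 ≤ Φ y) : 0 ≤ PG w s Φ := by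
  rw [PG_def]
  exact Finset.sum_nonneg fun τ _ => mul_nonneg (hw.1 τ) (integral_nonneg fun z => hΦ _)

/-- at SNR `0` the channel is blind: `P^w_0[Φ] = Φ(0)`. [folklore] -/
theorem PG_zero {w : (ι → ℤˣ) → ℝ} (hw : IsProbVec w) (Φ : (ι → ℝ) → ℝ) :
    PG w 0 Φ = Φ 0 := by
  rw [PG_def]
  have h : ∀ τ : ι → ℤˣ, (fun z : ι → ℝ => Φ (fun x => 0 * ((τ x : ℤ) : ℝ) + Real.sqrt 0 * z x)) =
      fun _ => Φ 0 := by
    intro τ; funext z; congr 1; funext x; simp [Real.sqrt_zero]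
  simp_rw [h, integral_const, smul_eq_mul]
  simp [← Finset.sum_mul, hw.2]

/-- the tilt at zero field is the prior expectation. [folklore] -/
theorem tiltG_zero {w : (ι → ℤˣ) → ℝ} (hw : IsProbVec w) (g : (ι → ℤˣ) → ℝ) :
    tiltG w 0 g = ∑ τ, w τ * g τ := by
  simp [tiltG, hw.2]

/-- `m_w(0)` is the first moment of the prior. [folklore] -/
theorem mG_zero {w : (ι → ℤˣ) → ℝ} (hw : IsProbVec w) : mG w 0 = mom w 1 := by
  simp [mG, tiltG_zero hw, mom]

/-- the clock rate is nonnegative. [folklore] -/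
theorem rG_nonneg (w : (ι → ℤˣ) → ℝ) (y : ι → ℝ) : 0 ≤ rG w y :=
  Finset.sum_nonneg fun _ _ => sq_nonneg _

/-- `E r_s ≥ 0`. [folklore] -/
theorem rateG_nonneg {w : (ι → ℤˣ) → ℝ} (hw : IsProbVec w) (s : ℝ) : 0 ≤ rateG w s :=
  PG_nonneg hw s (rG_nonneg w)

end Lemmas

/-! ## §4 From a uniform one-step expansion to a derivative (pure real analysis) -/

/-- If `|f(t+h) − f(t) − h D(t)| ≤ C h√h` for all `t ≥ 0`, `0 < h ≤ 1`, and `D` is continuous at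
`s > 0`, then `f` has derivative `D(s)` at `s` (two-sided). [folklore] -/
theorem hasDerivAt_of_expansion {f D : ℝ → ℝ} {C s : ℝ} (hs : 0 < s)
    (hexp : ∀ t : ℝ, 0 ≤ t → ∀ h : ℝ, 0 < h → h ≤ 1 → |f (t + h) - f t - h * D t| ≤ C * (h * Real.sqrt h))
    (hD : ContinuousAt D s) : HasDerivAt f (D s) s := by
  rw [hasDerivAt_iff_isLittleO_nhds_zero, Asymptotics.isLittleO_iff]
  intro ε hε
  have hC0 : 0 ≤ C := by
    have h := hexp 0 le_rfl 1 one_pos le_rfl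
    have : 0 ≤ C * (1 * Real.sqrt 1) := (abs_nonneg _).trans h
    simpa using this
  -- (1) `C √|h| < ε/2` near `0`
  have h1 : ∀ᶠ h : ℝ in 𝓝 0, C * Real.sqrt |h| < ε / 2 := by
    have hc : Continuous fun h : ℝ => C * Real.sqrt |h| :=
      continuous_const.mul (Real.continuous_sqrt.comp continuous_abs)
    have ht : Tendsto (fun h : ℝ => C * Real.sqrt |h|) (𝓝 0) (𝓝 0) := by
      simpa using hc.tendsto 0
    exact ht.eventually (gt_mem_nhds (by linarith))
  -- (2) `|D(s+h) − D(s)| < ε/2` near `0`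
  have h2 : ∀ᶠ h : ℝ in 𝓝 0, |D (s + h) - D s| < ε / 2 := by
    have ht : Tendsto (fun h : ℝ => D (s + h)) (𝓝 0) (𝓝 (D s)) := by
      have h0 : Tendsto (fun x : ℝ => s + x) (𝓝 0) (𝓝 s) := by
        have hc : Continuous fun x : ℝ => s + x := continuous_const.add continuous_id
        simpa using hc.tendsto (0 : ℝ)
      exact hD.tendsto.comp h0
    have := (Metric.tendsto_nhds.mp ht) (ε / 2) (by linarith)
    simpa [Real.dist_eq] using this
  -- (3) `|h| < min 1 s`
  have h3 : ∀ᶠ h : ℝ in 𝓝 0, |h| < min 1 s := by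
    have : Metric.ball (0 : ℝ) (min 1 s) ∈ 𝓝 (0 : ℝ) := Metric.ball_mem_nhds _ (by positivity)
    filter_upwards [this] with h hh
    simpa [Real.dist_eq] using hh
  filter_upwards [h1, h2, h3] with h hh1 hh2 hh3
  have hlt := lt_min_iff.mp hh3
  rcases lt_trichotomy h 0 with hneg | hzero | hpos
  · -- h < 0: expand at `t = s + h ≥ 0` with step `k = -h`
    set k := -h with hk
    have hkpos : 0 < k := by linarith
    have hk1 : k ≤ 1 := by have := hlt.1; rw [abs_of_neg hneg] at this; linarith
    have hks : k ≤ s := by have := hlt.2; rw [abs_of_neg hneg] at this; linarith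
    have ht0 : 0 ≤ s + h := by linarith
    have hE := hexp (s + h) ht0 k hkpos hk1
    have hsk : s + h + k = s := by rw [hk]; ring
    rw [hsk] at hE
    have hsq : Real.sqrt k = Real.sqrt |h| := by rw [abs_of_neg hneg]
    have hbound : C * (k * Real.sqrt k) ≤ k * (ε / 2) := by
      rw [hsq]
      have := mul_le_mul_of_nonneg_left hh1.le hkpos.le
      nlinarith [this]
    have hDk : k * |D (s + h) - D s| ≤ k * (ε / 2) := mul_le_mul_of_nonneg_left hh2.le hkpos.le
    have key : f (s + h) - f s - h * D s = -(f s - f (s + h) - k * D (s + h)) + k * (D s - D (s + h)) := by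
      rw [hk]; ring
    rw [Real.norm_eq_abs, Real.norm_eq_abs, smul_eq_mul, key, abs_of_neg hneg]
    calc |-(f s - f (s + h) - k * D (s + h)) + k * (D s - D (s + h))|
        ≤ |-(f s - f (s + h) - k * D (s + h))| + |k * (D s - D (s + h))| := abs_add_le _ _
      _ = |f s - f (s + h) - k * D (s + h)| + k * |D (s + h) - D s| := by
          rw [abs_neg, abs_mul, abs_of_pos hkpos, abs_sub_comm (D s)]
      _ ≤ k * (ε / 2) + k * (ε / 2) := add_le_add (hE.trans hbound) hDk
      _ = ε * -h := by rw [hk]; ring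
  · subst hzero; simp
  · have hE := hexp s hs.le h hpos (by have := hlt.1; rw [abs_of_pos hpos] at this; linarith)
    have hsq : Real.sqrt h = Real.sqrt |h| := by rw [abs_of_pos hpos]
    have hbound : C * (h * Real.sqrt h) ≤ h * (ε / 2) := by
      rw [hsq]
      have := mul_le_mul_of_nonneg_left hh1.le hpos.le
      nlinarith [this]
    rw [Real.norm_eq_abs, Real.norm_eq_abs, smul_eq_mul, abs_of_pos hpos]
    calc |f (s + h) - f s - h * D s| ≤ h * (ε / 2) := hE.trans hbound
      _ ≤ ε * h := by nlinarith


/-! ## §5 Derivatives of the clock moments from semigroup + generator + regularity -/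

section Clock

variable {ι : Type} [Fintype ι] [DecidableEq ι]

/-- `s`-sections of a jointly continuous functional are continuous on `[0, ∞)`. [folklore] -/
theorem continuousOn_section {F : ((ι → ℤˣ) → ℝ) × ℝ → ℝ}
    (hF : ContinuousOn F ({w | IsProbVec w} ×ˢ Set.Ici 0)) {w : (ι → ℤˣ) → ℝ} (hw : IsProbVec w) :
    ContinuousOn (fun s : ℝ => F (w, s)) (Set.Ici 0) :=
  hF.comp (continuousOn_const.prodMk continuousOn_id) fun _ hs => ⟨hw, hs⟩

/-- `w`-sections of a jointly continuous functional are continuous on the simplex. [folklore] -/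
theorem continuousOn_wsection {F : ((ι → ℤˣ) → ℝ) × ℝ → ℝ}
    (hF : ContinuousOn F ({w | IsProbVec w} ×ˢ Set.Ici 0)) {s : ℝ} (hs : 0 ≤ s) :
    ContinuousOn (fun w : (ι → ℤˣ) → ℝ => F (w, s)) {w | IsProbVec w} :=
  hF.comp (continuousOn_id.prodMk continuousOn_const) fun _ hw => ⟨hw, Set.mem_Ici.mpr hs⟩

/-- **Uniform one-step expansion of `E m_s²` and `E m_s⁴`** (semigroup + generator + regularity).
[folklore] -/
theorem clock_expansion (hS : ClockSemigroup) (hG : ClockGenerator) (hR : ClockRegularity)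
    (ι : Type) [Fintype ι] [DecidableEq ι] :
    ∃ C : ℝ, ∀ w : (ι → ℤˣ) → ℝ, IsProbVec w → ∀ t : ℝ, 0 ≤ t → ∀ h : ℝ, 0 < h → h ≤ 1 →
      |phiG w (t + h) - phiG w t - h * rateG w t| ≤ C * (h * Real.sqrt h) ∧
      |m4G w (t + h) - m4G w t - h * (6 * xG w t)| ≤ C * (h * Real.sqrt h) := by
  obtain ⟨C, hC⟩ := hG ι
  refine ⟨C, fun w hw t ht h hh hh1 => ?_⟩
  obtain ⟨hmc, hrc, hbd⟩ := (hR ι).1 w hw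
  set n : ℝ := (Fintype.card ι : ℝ) with hn
  have hm2c : Continuous fun y => mG w y ^ 2 := hmc.pow 2
  have hm4c : Continuous fun y => mG w y ^ 4 := hmc.pow 4
  have hm2b : ∀ y, |mG w y ^ 2| ≤ n ^ 2 := fun y => by
    rw [abs_pow]; exact pow_le_pow_left₀ (abs_nonneg _) (hbd y).1 2
  have hm4b : ∀ y, |mG w y ^ 4| ≤ n ^ 4 := fun y => by
    rw [abs_pow]; exact pow_le_pow_left₀ (abs_nonneg _) (hbd y).1 4
  have hrb : ∀ y, |rG w y| ≤ 4 * n ^ 3 := fun y => by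
    rw [abs_of_nonneg (hbd y).2.1]; exact (hbd y).2.2
  have hg4c : Continuous fun y => 6 * (rG w y * mG w y ^ 2) := continuous_const.mul (hrc.mul hm2c)
  have hg4b : ∀ y, |6 * (rG w y * mG w y ^ 2)| ≤ 6 * (4 * n ^ 3 * n ^ 2) := fun y => by
    rw [abs_mul, abs_mul, abs_of_pos (by norm_num : (0:ℝ) < 6)]
    refine mul_le_mul_of_nonneg_left ?_ (by norm_num)
    exact mul_le_mul (hrb y) (hm2b y) (abs_nonneg _) (by positivity)
  obtain ⟨hT2c, hT2b, hT2⟩ := hS ι w hw (fun y => mG w y ^ 2) (n ^ 2) hm2c hm2b h hh.le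
  obtain ⟨hT4c, hT4b, hT4⟩ := hS ι w hw (fun y => mG w y ^ 4) (n ^ 4) hm4c hm4b h hh.le
  have habs_h : |h| ≤ 1 := by rw [abs_of_pos hh]; exact hh1
  constructor
  · have hA : Continuous fun y => TG w h (fun y' => mG w y' ^ 2) y - mG w y ^ 2 := hT2c.sub hm2c
    have hAb : ∀ y, |TG w h (fun y' => mG w y' ^ 2) y - mG w y ^ 2| ≤ n ^ 2 + n ^ 2 := fun y =>
      (abs_sub _ _).trans (add_le_add (hT2b y) (hm2b y))
    have hB : Continuous fun y => h * rG w y := continuous_const.mul hrc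
    have hBb : ∀ y, |h * rG w y| ≤ 1 * (4 * n ^ 3) := fun y => by
      rw [abs_mul]; exact mul_le_mul habs_h (hrb y) (abs_nonneg _) zero_le_one
    have e : phiG w (t + h) - phiG w t - h * rateG w t =
        PG w t (fun y => TG w h (fun y' => mG w y' ^ 2) y - mG w y ^ 2 - h * rG w y) := by
      rw [PG_sub w t hA hAb hB hBb, PG_sub w t hT2c hT2b hm2c hm2b, PG_const_mul, ← hT2 t ht]
      rfl
    rw [e]
    exact abs_PG_le hw t fun y => (hC w hw h hh hh1 y).1
  · have hA : Continuous fun y => TG w h (fun y' => mG w y' ^ 4) y - mG w y ^ 4 := hT4c.sub hm4c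
    have hAb : ∀ y, |TG w h (fun y' => mG w y' ^ 4) y - mG w y ^ 4| ≤ n ^ 4 + n ^ 4 := fun y =>
      (abs_sub _ _).trans (add_le_add (hT4b y) (hm4b y))
    have hB : Continuous fun y => h * (6 * (rG w y * mG w y ^ 2)) := continuous_const.mul hg4c
    have hBb : ∀ y, |h * (6 * (rG w y * mG w y ^ 2))| ≤ 1 * (6 * (4 * n ^ 3 * n ^ 2)) := fun y => by
      rw [abs_mul]; exact mul_le_mul habs_h (hg4b y) (abs_nonneg _) zero_le_one
    have e : m4G w (t + h) - m4G w t - h * (6 * xG w t) =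
        PG w t (fun y => TG w h (fun y' => mG w y' ^ 4) y - mG w y ^ 4 -
          h * (6 * (rG w y * mG w y ^ 2))) := by
      rw [PG_sub w t hA hAb hB hBb, PG_sub w t hT4c hT4b hm4c hm4b, PG_const_mul, PG_const_mul,
        ← hT4 t ht]
      rfl
    rw [e]
    exact abs_PG_le hw t fun y => (hC w hw h hh hh1 y).2

/-- **The clock in derivative form**: for a probability vector `w` and `s > 0`,
`(E m_s²)' = E r_s` and `(E m_s⁴)' = 6 E[r_s m_s²]`. [folklore] -/
theorem clock_hasDerivAt (hS : ClockSemigroup) (hG : ClockGenerator) (hR : ClockRegularity)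
    {w : (ι → ℤˣ) → ℝ} (hw : IsProbVec w) {s : ℝ} (hs : 0 < s) :
    HasDerivAt (phiG w) (rateG w s) s ∧ HasDerivAt (m4G w) (6 * xG w s) s := by
  obtain ⟨C, hC⟩ := clock_expansion hS hG hR ι
  have hRc : ContinuousAt (rateG w) s :=
    (continuousOn_section (hR ι).2.2.2.1 hw).continuousAt (Ici_mem_nhds hs)
  have hX0 : ContinuousAt (fun s => xG w s) s :=
    (continuousOn_section (hR ι).2.2.2.2 hw).continuousAt (Ici_mem_nhds hs)
  have hXc : ContinuousAt (fun s => 6 * xG w s) s := continuousAt_const.mul hX0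
  exact ⟨hasDerivAt_of_expansion hs (fun t ht h hh hh1 => (hC w hw t ht h hh hh1).1) hRc,
    hasDerivAt_of_expansion hs (fun t ht h hh hh1 => (hC w hw t ht h hh hh1).2) hXc⟩

end Clock

/-! ## §6 The sign of the critical clock covariance (LocalisationGHS on free boxes → `w_L`) -/

/-- **`Cov(r_s, M_s²) ≤ 0` for the plus-state block law**, from `FreeBoxClockSign`, the free-box
limit of `PlusBlockLaw` and the continuity in the prior of `ClockRegularity`. [folklore] -/
theorem plus_cov_nonpos (hR : ClockRegularity) (hBL : PlusBlockLaw) (hFS : FreeBoxClockSign)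
    (hGHS : LocalisationGHS) (L : ℕ) {s : ℝ} (hs : 0 ≤ s) : covG (wL L) s ≤ 0 := by
  obtain ⟨hwL, -, -, -, -, hfreeP, hlim⟩ := hBL L
  obtain ⟨-, hphi, -, hrate, hx⟩ := hR ↥(box 3 L)
  have hcovw : ContinuousOn (fun w : (↥(box 3 L) → ℤˣ) → ℝ => covG w s) {w | IsProbVec w} := by
    have h1 := continuousOn_wsection hx hs
    have h2 := continuousOn_wsection hrate hs
    have h3 := continuousOn_wsection hphi hs
    exact h1.sub (h2.mul h3)
  have htend : Tendsto (fun L' : ℕ => wFree L L') atTop (𝓝 (wL L)) := tendsto_pi_nhds.mpr hlim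
  have hmem : ∀ᶠ L' in atTop, wFree L L' ∈ {w : (↥(box 3 L) → ℤˣ) → ℝ | IsProbVec w} :=
    eventually_atTop.mpr ⟨L, fun L' h => hfreeP L' h⟩
  have htendW : Tendsto (fun L' : ℕ => wFree L L') atTop (𝓝[{w | IsProbVec w}] (wL L)) :=
    tendsto_nhdsWithin_iff.mpr ⟨htend, hmem⟩
  have hlimcov : Tendsto (fun L' : ℕ => covG (wFree L L') s) atTop (𝓝 (covG (wL L) s)) :=
    (hcovw (wL L) hwL).tendsto.comp htendW
  exact le_of_tendsto hlimcov (eventually_atTop.mpr ⟨L, fun L' h => hFS hGHS L L' h s hs⟩)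

/-! ## §7 Composition — the crux BY NAME from the six stub statements (sorry-free) -/

/-- **The clock reading, derivative form (composition, sorry-free).** From the six registered stubs:
`LocalisationGHS → ImryMaWindowNoise → Target` with `c_Target = 6ca(b − a)`. The function
`G(s) = E m_s⁴ − 3(E m_s²)²` has `G' = 6 Cov(r_s, m_s²) ≤ 0`, `G(0) = 0`, `G(∞) = ⟨M⁴⟩ − 3σ_L⁴`; on the
interquantile window `[s₁, s₂]` (IVT on the nondecreasing clock `φ = E m_s²`, `φ' = E r_s ≥ 0`,
`φ(0) = 0`, `φ(∞) = σ_L²`) the function `G + 6caσ_L² φ` is nonincreasing, whence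
`⟨M⁴⟩ − 3σ_L⁴ ≤ G(s₂) ≤ G(s₁) − 6ca(b−a)σ_L⁴ ≤ −6ca(b−a)σ_L⁴`. [folklore] -/
theorem TargetOfClock_of (h1 : Registered.stub_semigroup) (h2 : Registered.stub_generator)
    (h3 : Registered.stub_regularity) (h4 : Registered.stub_limit)
    (h5 : Registered.stub_plusBlockLaw) (h6 : Registered.stub_freeBoxClockSign) : TargetOfClock := by
  show LocalisationGHS → ImryMaWindowNoise → Target
  intro hGHS hIM
  obtain ⟨a, b, c, ha, hab, hb1, hc, L₀, hwin⟩ := imryMaWindowNoise_iff.mp hIM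
  have hba : 0 < b - a := sub_pos.mpr hab
  refine target_iff.mpr ⟨6 * c * a * (b - a), by positivity, L₀, fun L hL => ?_⟩
  obtain ⟨hw, hm1, hm2, hm4, hσ, -, -⟩ := h5 L
  -- the four functions of the SNR
  set φ : ℝ → ℝ := phiG (wL L) with hφdef
  set R : ℝ → ℝ := rateG (wL L) with hRdef
  set G : ℝ → ℝ := fun s => m4G (wL L) s - 3 * phiG (wL L) s ^ 2 with hGdef
  -- continuity on `[0, ∞)`
  have hφc : ContinuousOn φ (Set.Ici 0) := continuousOn_section (h3 _).2.1 hw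
  have hm4c : ContinuousOn (m4G (wL L)) (Set.Ici 0) := continuousOn_section (h3 _).2.2.1 hw
  have hGc : ContinuousOn G (Set.Ici 0) := hm4c.sub (continuousOn_const.mul (hφc.pow 2))
  -- derivatives on `(0, ∞)`
  have hder : ∀ s : ℝ, 0 < s →
      HasDerivAt φ (R s) s ∧ HasDerivAt (m4G (wL L)) (6 * xG (wL L) s) s :=
    fun s hs => clock_hasDerivAt h1 h2 h3 hw hs
  have hGder : ∀ s : ℝ, 0 < s → HasDerivAt G (6 * covG (wL L) s) s := by
    intro s hs
    have key := (hder s hs).2.sub (((hder s hs).1.pow 2).const_mul 3)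
    have e : 6 * covG (wL L) s = 6 * xG (wL L) s - 3 * (↑(2:ℕ) * phiG (wL L) s ^ (2 - 1) * R s) := by
      simp only [covG, Nat.cast_ofNat, hRdef]
      ring
    rw [e]
    exact key
  -- values at `0`
  have hm0 : mG (wL L) 0 = 0 := by rw [mG_zero hw, hm1]
  have hφ0 : φ 0 = 0 := by
    show PG (wL L) 0 (fun y => mG (wL L) y ^ 2) = 0
    rw [PG_zero hw, hm0]; norm_num
  have hG0 : G 0 = 0 := by
    show PG (wL L) 0 (fun y => mG (wL L) y ^ 4) - 3 * PG (wL L) 0 (fun y => mG (wL L) y ^ 2) ^ 2 = 0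
    rw [PG_zero hw, PG_zero hw, hm0]; norm_num
  -- signs
  have hcov : ∀ s : ℝ, 0 ≤ s → covG (wL L) s ≤ 0 := fun s hs => plus_cov_nonpos h3 h5 h6 hGHS L hs
  have hR0 : ∀ s : ℝ, 0 ≤ R s := fun s => rateG_nonneg hw s
  -- the clock is nondecreasing, `G` is nonincreasing on `[0, ∞)`
  have hφmono : MonotoneOn φ (Set.Ici 0) := by
    refine monotoneOn_of_deriv_nonneg (convex_Ici 0) hφc (fun s hs => ?_) (fun s hs => ?_)
    · rw [interior_Ici] at hs
      exact (hder s hs).1.differentiableAt.differentiableWithinAt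
    · rw [interior_Ici] at hs
      rw [(hder s hs).1.deriv]; exact hR0 s
  have hGanti : AntitoneOn G (Set.Ici 0) := by
    refine antitoneOn_of_deriv_nonpos (convex_Ici 0) hGc (fun s hs => ?_) (fun s hs => ?_)
    · rw [interior_Ici] at hs
      exact (hGder s hs).differentiableAt.differentiableWithinAt
    · rw [interior_Ici] at hs
      rw [(hGder s hs).deriv]
      linarith [hcov s hs.le]
  -- limits at infinite SNR
  obtain ⟨hφlim, hm4lim⟩ := h4 _ (wL L) hw
  rw [hm2] at hφlim
  rw [hm4] at hm4lim
  have hGlim : Tendsto G atTop (𝓝 (M4 L - 3 * sigma2 L ^ 2)) :=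
    hm4lim.sub ((hφlim.pow 2).const_mul 3)
  -- the window `[s₁, s₂]` by the intermediate value theorem
  have hbσ : b * sigma2 L < sigma2 L := by
    have h := mul_lt_mul_of_pos_right hb1 hσ
    rwa [one_mul] at h
  obtain ⟨S, hS0, hS⟩ : ∃ S : ℝ, 0 ≤ S ∧ b * sigma2 L < φ S := by
    have hev : ∀ᶠ s in atTop, b * sigma2 L < φ s := hφlim.eventually (lt_mem_nhds hbσ)
    obtain ⟨S, hS⟩ := ((eventually_ge_atTop (0 : ℝ)).and hev).exists
    exact ⟨S, hS.1, hS.2⟩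
  have hcontS : ContinuousOn φ (Set.Icc 0 S) := hφc.mono Set.Icc_subset_Ici_self
  have haσ_mem : a * sigma2 L ∈ Set.Icc (φ 0) (φ S) := by
    rw [hφ0]; exact ⟨(mul_pos ha hσ).le, by nlinarith⟩
  have hbσ_mem : b * sigma2 L ∈ Set.Icc (φ 0) (φ S) := by
    rw [hφ0]; exact ⟨by nlinarith [(mul_pos ha hσ).le], hS.le⟩
  obtain ⟨s₁, hs₁, hφ₁⟩ := intermediate_value_Icc hS0 hcontS haσ_mem
  obtain ⟨s₂, hs₂, hφ₂⟩ := intermediate_value_Icc hS0 hcontS hbσ_mem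
  have h12 : s₁ ≤ s₂ := by
    by_contra h
    have h' := hφmono (Set.mem_Ici.mpr hs₂.1) (Set.mem_Ici.mpr hs₁.1) (not_le.mp h).le
    rw [hφ₁, hφ₂] at h'
    nlinarith
  have hs1pos : 0 < s₁ := by
    rcases eq_or_lt_of_le hs₁.1 with h0 | h0
    · exfalso
      rw [← h0, hφ0] at hφ₁
      nlinarith [mul_pos ha hσ]
    · exact h0
  -- on the window `K = G + 6caσ² φ` is nonincreasing
  have hK : AntitoneOn (fun s => G s + 6 * c * a * sigma2 L * φ s) (Set.Icc s₁ s₂) := by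
    have hKc : ContinuousOn (fun s => G s + 6 * c * a * sigma2 L * φ s) (Set.Icc s₁ s₂) :=
      (hGc.mono fun s hs => hs1pos.le.trans hs.1).add
        (continuousOn_const.mul (hφc.mono fun s hs => hs1pos.le.trans hs.1))
    refine antitoneOn_of_deriv_nonpos (convex_Icc s₁ s₂) hKc (fun s hs => ?_) (fun s hs => ?_)
    · rw [interior_Icc] at hs
      have hs0 : 0 < s := hs1pos.trans hs.1
      exact ((hGder s hs0).add (((hder s hs0).1).const_mul _)).differentiableAt.differentiableWithinAt
    · rw [interior_Icc] at hs
      have hs0 : 0 < s := hs1pos.trans hs.1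
      have hKd : HasDerivAt (fun s => G s + 6 * c * a * sigma2 L * φ s)
          (6 * covG (wL L) s + 6 * c * a * sigma2 L * R s) s :=
        (hGder s hs0).add (((hder s hs0).1).const_mul _)
      rw [hKd.deriv]
      have hlo : a * sigma2 L ≤ φ s := by
        rw [← hφ₁]; exact hφmono (Set.mem_Ici.mpr hs₁.1) (Set.mem_Ici.mpr hs0.le) hs.1.le
      have hhi : φ s ≤ b * sigma2 L := by
        rw [← hφ₂]; exact hφmono (Set.mem_Ici.mpr hs0.le) (Set.mem_Ici.mpr hs₂.1) hs.2.le
      have hw' := hwin L hL s hs0.le hlo hhi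
      have hr := hR0 s
      have key : c * a * sigma2 L * R s ≤ c * (R s * φ s) := by
        have h1' : R s * (a * sigma2 L) ≤ R s * φ s := mul_le_mul_of_nonneg_left hlo hr
        nlinarith [h1', hc.le]
      change covG (wL L) s ≤ -(c * (R s * φ s)) at hw'
      nlinarith [hw', key]
  have hK12 := hK (Set.left_mem_Icc.mpr h12) (Set.right_mem_Icc.mpr h12) h12
  -- `G(s₁) ≤ G(0) = 0` and `⟨M⁴⟩ − 3σ⁴ ≤ G(s₂)`
  have hG1 : G s₁ ≤ 0 := by
    have := hGanti (Set.mem_Ici.mpr le_rfl) (Set.mem_Ici.mpr hs₁.1) hs₁.1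
    rwa [hG0] at this
  have hGinf : M4 L - 3 * sigma2 L ^ 2 ≤ G s₂ :=
    le_of_tendsto hGlim (eventually_atTop.mpr ⟨s₂, fun t ht =>
      hGanti (Set.mem_Ici.mpr hs₂.1) (Set.mem_Ici.mpr (hs₂.1.trans ht)) ht⟩)
  -- assemble
  have hfin : M4 L - 3 * sigma2 L ^ 2 ≤ -(6 * c * a * (b - a) * sigma2 L ^ 2) := by
    have e : -(6 * c * a * (b - a) * sigma2 L ^ 2) =
        -(6 * c * a * sigma2 L) * (φ s₂ - φ s₁) := by rw [hφ₁, hφ₂]; ring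
    rw [e]
    simp only at hK12
    nlinarith [hK12, hG1, hGinf]
  rw [le_div_iff₀ (by positivity)]
  linarith

/-- **`TargetOfClock_proof`** — the crux with NO hypotheses from the six declared `stub_*` through
the sorry-free composition; closed modulo exactly the six stubs. [folklore] -/
theorem TargetOfClock_proof : TargetOfClock :=
  TargetOfClock_of stub_semigroup stub_generator stub_regularity stub_limit stub_plusBlockLaw
    stub_freeBoxClockSign

end Summit.CriticalPhenomena.Ising3DConformalLimit.Cruxes.TargetOfClock.SemigroupClock

end
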